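import Literature.AlgebraicGeometry.HodgeTheory.WeilClassesFieldProducts
import Literature.AlgebraicGeometry.HodgeTheory.NoTypeIVFactorOrthogonalProducts
import Literature.AlgebraicGeometry.HodgeTheory.HodgeTypeExteriorProduct
import Literature.NumberTheory.Transcendental.DeRhamTheoremMultiplicative
import HarnessLib

/-!
# Weil classes of a product, II: ORTHOGONAL factors (`Hom(A₁, A₂) = 0 = Hom(A₂, A₁)`) — every action of
# `F = ℚ[T]/(P)` on `A₁ × A₂` is diagonal and acts on each factor; the Weil classes of the product are Hodge
# when those of the factors are (Moonen–Zarhin 1998 §2, first paragraph, as printed)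

Layer `Literature/AlgebraicGeometry/HodgeTheory`, theorem-only companion of `WeilClassesFieldProducts` (the
product step `W_F(A₁ × A₂) ⊗ ℂ ⊆ span {fst^* a ⌣ snd^* b}` for a DIAGONAL action `Ψ = φ₁ × φ₂`, stated with
the two commutation hypotheses `Ψ ≫ fst = fst ≫ φ₁`, `Ψ ≫ snd = snd ≫ φ₂` and with `P(φ₁) = 0`, `P(φ₂) = 0`) and
of `NoTypeIVFactorOrthogonalProducts` (Lange 2023 Cor. 2.4.26 / Mumford §19 Cor. 2: for ORTHOGONAL factors every
endomorphism of `A₁ × A₂` is block-diagonal, `eq_inlEnd_add_inrEnd_of_orthogonal`).  THIS file supplies the two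
sentences with which Moonen–Zarhin open their §2 and removes the diagonal-action hypotheses of
`WeilClassesFieldProducts` for orthogonal factors; and it adds the HODGE-CLASS form of the product step.

PRINTED STATEMENT.  B. J. J. Moonen – Yu. G. Zarhin, *Weil classes on abelian varieties*, J. reine angew. Math. 496
(1998) 83–92 = arXiv:alg-geom/9612017 (held text `paper:arxiv-alg-geom_9612017`), §2 (chunk p0002, lines 1–13):
«`X ∼ Y₁^{m₁} × ⋯ × Y_k^{m_k}` where `Y₁, …, Y_k` are simple, mutually non-isogenous, abelian varieties […].  The
condition that `1 ∈ F` acts as the identity implies that `F` acts on each factor `Y_i^{m_i}`, and that the action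
of `F` on `X` is the “diagonal action” w.r.t. the decomposition.  Write `r_i = 2 m_i dim(Y_i)/[F:ℚ]`, so that
`r = r₁ + ⋯ + r_k`. […] We claim that the space `W_F(X)` can be identified with the tensor product
`W_F(Y₁^{m₁}) ⊗_F … ⊗_F W_F(Y_k^{m_k})`, considered as a subspace of the Künneth component […]»; (lines 21–31)
«We conclude from this that, if `W_F(X)` consists of Hodge classes, then `W_F(X)` consists of decomposable Hodge
classes ⟺ each of the spaces `W_F(Y_i^{m_i})` consists of decomposable Hodge classes»; and the Example
(lines 33–38): «Let `X = Y₁ × Y₂` where the ratios `2 dim(Y₁)/[F:ℚ]` and `2 dim(Y₂)/[F:ℚ]` are odd.  Then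
non-zero elements of `W_F(Y₁)` and `W_F(Y₂)` are not Hodge classes …» (so only the implication «factors Hodge ⟹
product Hodge» holds in general; it is the case `rᵢ = 2mᵢ` of §3 below).

WHAT IS PROVED (theorems only; no definition, no named fact).  `A₁`, `A₂` complex abelian varieties,
`Ψ : A₁ × A₂ ⟶ A₁ × A₂`, `P ∈ ℤ[T]`.
* §1 ORTHOGONAL FACTORS ⟹ DIAGONAL ACTION: `comp_fst_eq_fst_comp_cornerFst_of_orthogonal` — if `Hom(A₁, A₂) = 0`
  and `Hom(A₂, A₁) = 0` then `Ψ ≫ fst = fst ≫ corner₁(Ψ)` and (`comp_snd_eq_snd_comp_cornerSnd_of_orthogonal`)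
  `Ψ ≫ snd = snd ≫ corner₂(Ψ)`, with the corners `cornerFst A₁ A₂ Ψ = ι₁ ≫ Ψ ≫ pr₁`, `cornerSnd` of
  `Milne1999.CMTypeProducts` (from `eq_inlEnd_add_inrEnd_of_orthogonal`: `Ψ = diag(corner₁ Ψ, corner₂ Ψ)`).
* §2 `F` ACTS ON EACH FACTOR: `eval₂_eq_zero_of_comp_fst` / `eval₂_eq_zero_of_comp_snd` — for a diagonal `Ψ`
  (`Ψ ≫ fst = fst ≫ φ₁`, `Ψ ≫ snd = snd ≫ φ₂`), `P(Ψ) = 0 ⟹ P(φ₁) = 0` and `P(φ₂) = 0` (`P(Ψ) = P(φ₁) × P(φ₂)`,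
  `WeilClassesFieldProducts.eval₂_prodLift_fst_snd`, restricted along `ι₁ = (𝟙, 0)`, `ι₂ = (0, 𝟙)`); hence for
  orthogonal factors `eval₂_cornerFst_eq_zero_of_orthogonal`, `eval₂_cornerSnd_eq_zero_of_orthogonal`.
* §3 THE PRODUCT STEP FOR HODGE CLASSES (`rᵢ = 2mᵢ`): **`forall_isOfHodgeType_weilClassesField_prod`** — for a
  diagonal `Ψ`, `P` monic irreducible of degree `e`, `P(φᵢ) = 0`, `e · 2mᵢ = 2 dim Aᵢ`: if `W_F(A₁) ⊗ ℂ ⊆ H^{m₁,m₁}`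
  and `W_F(A₂) ⊗ ℂ ⊆ H^{m₂,m₂}` then `W_F(A₁ × A₂) ⊗ ℂ ⊆ H^{m₁+m₂, m₁+m₂}` (the Weil classes of the product lie in
  the span of the exterior products `fst^* a ⌣ snd^* b`, `weilClassesField_prod_le_span_cupProduct`, and Hodge types
  add under exterior products — Voisin I Thm. 11.38, the tree's
  `isOfHodgeType_cupProduct_map_fst_map_snd_of_cupPreservesHodgeType` with `CupPreservesHodgeType` of the product
  DISCHARGED by the multiplicative de Rham theorem `exists_deRhamIsoFamily_holds`); and for powers
  **`forall_isOfHodgeType_weilClassesField_powSucc`** (`W_F(A) ⊗ ℂ` Hodge ⟹ `W_F(A^{a+1}) ⊗ ℂ` Hodge, all `a`).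
* §4 ORTHOGONAL FACTORS, HYPOTHESIS-FREE FORM of the product step: for `Hom(A₁, A₂) = 0 = Hom(A₂, A₁)`, ANY `Ψ`
  with `P(Ψ) = 0` (`P` monic irreducible of degree `e`, `e · rᵢ = 2 dim Aᵢ`):
  **`weilClassesField_prod_le_span_cupProduct_of_orthogonal`** (`W_F(A₁ × A₂) ⊗ ℂ ⊆ span {fst^* a ⌣ snd^* b | a ∈
  W_F(A₁, corner₁ Ψ) ⊗ ℂ, b ∈ W_F(A₂, corner₂ Ψ) ⊗ ℂ}` — Moonen–Zarhin's identification for two orthogonal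
  factors), **`weilClassesField_prod_le_algebraicClasses_of_orthogonal`**,
  **`weilClassesField_prod_le_divisorClassesSpan_of_orthogonal`** (their «⟸»),
  **`forall_isOfHodgeType_weilClassesField_prod_of_orthogonal`**.

Not treated here: `k ≥ 3` orthogonal factors at once (iterate); the isogeny `X ∼ ∏ Y_i^{m_i}` itself (transport
of `W_F` along `F`-isogenies is `WeilClassesIsogenyDescent`); the converse «⟹» of the displayed equivalence.

No `sorry`; axioms `propext`, `Classical.choice`, `Quot.sound`.

## References
* [MoonenZarhin1998WeilClasses] B. J. J. Moonen, Yu. G. Zarhin, *Weil classes on abelian varieties*, J. reine angew.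
  Math. 496 (1998) 83–92 = arXiv:alg-geom/9612017, §2 first paragraph, display and Example (chunk p0002).
* [Lange2023AbelianVarietiesC] H. Lange, *Abelian Varieties over the Complex Numbers* (2023), Cor. 2.4.26 (proof:
  `End(X) = ⊕ End(X_ν)` for `Hom(X_ν, X_μ) = 0`).
* [MumfordAV1970] D. Mumford, *Abelian Varieties* (1970), §19 Cor. 2 (p. 174) and `Hom(C, A × B) = Hom(C, A) ⊕ Hom(C, B)`.
* [VoisinHodgeI2002] C. Voisin, *Hodge Theory and Complex Algebraic Geometry I* (2002), §7.3.2, §11.3.2 Thm. 11.38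
  (Künneth and Hodge types).
* [Schoen1998HodgeWeilAddendum] C. Schoen, Compositio Math. 114 (1998), §10 (proof, p. 333: «`W_{A′}` has Hodge type
  `(1,1)`», the product of a Weil fourfold and a Weil surface is a Weil sixfold).
-/

noncomputable section

open CategoryTheory Polynomial

namespace Literature.AlgebraicGeometry.HodgeTheory

section HodgeTheory

open Literature.AlgebraicTopology.SingularHomology
open Literature.AlgebraicGeometry.Motives
open Literature.AlgebraicGeometry.Milne1999.CMTypeProducts (blockDiag cornerFst cornerSnd blockDiag_add)
open Literature.Barriers.HodgeConjecture (divisorClassesSpan)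

variable {A₁ A₂ : Motives.AbelianVariety ℂ} {φ₁ : A₁ ⟶ A₁} {φ₂ : A₂ ⟶ A₂} {Ψ : A₁.prod A₂ ⟶ A₁.prod A₂}
  {P : Polynomial ℤ} {e r₁ r₂ : ℕ}

/-! ### §1 Orthogonal factors: every endomorphism of `A₁ × A₂` is diagonal -/

section Orthogonal

/-- `diag(f, g) ≫ pr₁ = pr₁ ≫ f` for the block-diagonal endomorphism of `Milne1999.CMTypeProducts` (read through
`A₁ ⊞ A₂ ≅ A₁ × A₂`, `biprodIsoProd_hom_fst`). [folklore] [cite: MumfordAV1970, §19] -/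
theorem blockDiag_comp_fst (f : A₁ ⟶ A₁) (g : A₂ ⟶ A₂) :
    blockDiag A₁ A₂ f g ≫ AbelianVariety.fst A₁ A₂ = AbelianVariety.fst A₁ A₂ ≫ f := by
  have hfst : AbelianVariety.fst A₁ A₂ = (AbelianVariety.biprodIsoProd A₁ A₂).inv ≫ Limits.biprod.fst := by
    rw [← AbelianVariety.biprodIsoProd_hom_fst, Iso.inv_hom_id_assoc]
  rw [hfst]
  simp [blockDiag]

/-- `diag(f, g) ≫ pr₂ = pr₂ ≫ g`. [folklore] [cite: MumfordAV1970, §19] -/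
theorem blockDiag_comp_snd (f : A₁ ⟶ A₁) (g : A₂ ⟶ A₂) :
    blockDiag A₁ A₂ f g ≫ AbelianVariety.snd A₁ A₂ = AbelianVariety.snd A₁ A₂ ≫ g := by
  have hsnd : AbelianVariety.snd A₁ A₂ = (AbelianVariety.biprodIsoProd A₁ A₂).inv ≫ Limits.biprod.snd := by
    rw [← AbelianVariety.biprodIsoProd_hom_snd, Iso.inv_hom_id_assoc]
  rw [hsnd]
  simp [blockDiag]

/-- **For orthogonal factors every endomorphism of `A₁ × A₂` is block-diagonal**: if `Hom(A₁, A₂) = 0` and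
`Hom(A₂, A₁) = 0` then `Ψ = diag(corner₁ Ψ, corner₂ Ψ)` (the tree's `eq_inlEnd_add_inrEnd_of_orthogonal`, Lange
2023 Cor. 2.4.26, read back in `Hom`). [cite: Lange2023AbelianVarietiesC, proof of Cor. 2.4.26]
[cite: MumfordAV1970, §19 Cor. 2 (p. 174)] [cite: MoonenZarhin1998WeilClasses, §2 (chunk p0002, lines 1–6)] -/
theorem blockDiag_cornerFst_cornerSnd_of_orthogonal (hAB : ∀ f : A₁ ⟶ A₂, f = 0) (hBA : ∀ g : A₂ ⟶ A₁, g = 0)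
    (Ψ : A₁.prod A₂ ⟶ A₁.prod A₂) : blockDiag A₁ A₂ (cornerFst A₁ A₂ Ψ) (cornerSnd A₁ A₂ Ψ) = Ψ := by
  have h := NoTypeIVFactorProducts.eq_inlEnd_add_inrEnd_of_orthogonal hAB hBA (Ψ : CategoryTheory.End (A₁.prod A₂))
  change Ψ = blockDiag A₁ A₂ (cornerFst A₁ A₂ Ψ) 0 + blockDiag A₁ A₂ 0 (cornerSnd A₁ A₂ Ψ) at h
  rw [← blockDiag_add, add_zero, zero_add] at h
  exact h.symm

/-- **Orthogonal factors ⟹ the action is diagonal, first projection**: `Ψ ≫ pr₁ = pr₁ ≫ corner₁(Ψ)` («the action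
of `F` on `X` is the “diagonal action” w.r.t. the decomposition»). [cite: MoonenZarhin1998WeilClasses, §2 (chunk
p0002, lines 1–6)] [cite: Lange2023AbelianVarietiesC, proof of Cor. 2.4.26] -/
theorem comp_fst_eq_fst_comp_cornerFst_of_orthogonal (hAB : ∀ f : A₁ ⟶ A₂, f = 0)
    (hBA : ∀ g : A₂ ⟶ A₁, g = 0) (Ψ : A₁.prod A₂ ⟶ A₁.prod A₂) :
    Ψ ≫ AbelianVariety.fst A₁ A₂ = AbelianVariety.fst A₁ A₂ ≫ cornerFst A₁ A₂ Ψ :=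
  calc Ψ ≫ AbelianVariety.fst A₁ A₂
        = blockDiag A₁ A₂ (cornerFst A₁ A₂ Ψ) (cornerSnd A₁ A₂ Ψ) ≫ AbelianVariety.fst A₁ A₂ := by
          rw [blockDiag_cornerFst_cornerSnd_of_orthogonal hAB hBA Ψ]
    _ = AbelianVariety.fst A₁ A₂ ≫ cornerFst A₁ A₂ Ψ := blockDiag_comp_fst _ _

/-- **Orthogonal factors ⟹ the action is diagonal, second projection**: `Ψ ≫ pr₂ = pr₂ ≫ corner₂(Ψ)`.
[cite: MoonenZarhin1998WeilClasses, §2 (chunk p0002, lines 1–6)] [cite: Lange2023AbelianVarietiesC, proof of Cor. 2.4.26] -/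
theorem comp_snd_eq_snd_comp_cornerSnd_of_orthogonal (hAB : ∀ f : A₁ ⟶ A₂, f = 0)
    (hBA : ∀ g : A₂ ⟶ A₁, g = 0) (Ψ : A₁.prod A₂ ⟶ A₁.prod A₂) :
    Ψ ≫ AbelianVariety.snd A₁ A₂ = AbelianVariety.snd A₁ A₂ ≫ cornerSnd A₁ A₂ Ψ :=
  calc Ψ ≫ AbelianVariety.snd A₁ A₂
        = blockDiag A₁ A₂ (cornerFst A₁ A₂ Ψ) (cornerSnd A₁ A₂ Ψ) ≫ AbelianVariety.snd A₁ A₂ := by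
          rw [blockDiag_cornerFst_cornerSnd_of_orthogonal hAB hBA Ψ]
    _ = AbelianVariety.snd A₁ A₂ ≫ cornerSnd A₁ A₂ Ψ := blockDiag_comp_snd _ _

end Orthogonal

/-! ### §2 `F` acts on each factor: `P(Ψ) = 0 ⟹ P(φ₁) = 0`, `P(φ₂) = 0` -/

section Factors

/-- `(pr₁ ≫ χ₁, pr₂ ≫ χ₂) = 0 ⟹ χ₁ = 0 ∧ χ₂ = 0` (restrict along `ι₁ = (𝟙, 0)` and `ι₂ = (0, 𝟙)`). [folklore]
[cite: MumfordAV1970, §19] -/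
private theorem eq_zero_of_prodLift_comp_eq_zero {χ₁ : A₁ ⟶ A₁} {χ₂ : A₂ ⟶ A₂}
    (h : AbelianVariety.prodLift (AbelianVariety.fst A₁ A₂ ≫ χ₁) (AbelianVariety.snd A₁ A₂ ≫ χ₂) = 0) :
    χ₁ = 0 ∧ χ₂ = 0 := by
  constructor
  · have h₁ : (AbelianVariety.prodLift (𝟙 A₁) (0 : A₁ ⟶ A₂) ≫
        AbelianVariety.prodLift (AbelianVariety.fst A₁ A₂ ≫ χ₁) (AbelianVariety.snd A₁ A₂ ≫ χ₂)) ≫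
          AbelianVariety.fst A₁ A₂ = χ₁ := by
      simp
    rw [← h₁, h]
    simp
  · have h₂ : (AbelianVariety.prodLift (0 : A₂ ⟶ A₁) (𝟙 A₂) ≫
        AbelianVariety.prodLift (AbelianVariety.fst A₁ A₂ ≫ χ₁) (AbelianVariety.snd A₁ A₂ ≫ χ₂)) ≫
          AbelianVariety.snd A₁ A₂ = χ₂ := by
      simp
    rw [← h₂, h]
    simp

/-- **`P(φ₁ × φ₂) = 0 ⟹ P(φ₁) = 0`** («`F` acts on each factor»): for a diagonal `Ψ` (`Ψ ≫ fst = fst ≫ φ₁`,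
`Ψ ≫ snd = snd ≫ φ₂`), `P(Ψ) = (pr₁ ≫ P(φ₁), pr₂ ≫ P(φ₂))` (`eval₂_prodLift_fst_snd`), and a diagonal endomorphism
vanishes only if both its entries do. [cite: MoonenZarhin1998WeilClasses, §2 (chunk p0002, lines 1–6)]
[cite: MumfordAV1970, §19] -/
theorem eval₂_eq_zero_of_comp_fst (hΨ₁ : Ψ ≫ AbelianVariety.fst A₁ A₂ = AbelianVariety.fst A₁ A₂ ≫ φ₁)
    (hΨ₂ : Ψ ≫ AbelianVariety.snd A₁ A₂ = AbelianVariety.snd A₁ A₂ ≫ φ₂)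
    (hΨ : Polynomial.eval₂ (Int.castRingHom (CategoryTheory.End (A₁.prod A₂)))
      (Ψ : CategoryTheory.End (A₁.prod A₂)) P = 0) :
    Polynomial.eval₂ (Int.castRingHom (CategoryTheory.End A₁)) (φ₁ : CategoryTheory.End A₁) P = 0 := by
  have h := eval₂_prodLift_fst_snd hΨ₁ hΨ₂ P
    (χ₁ := (Polynomial.eval₂ (Int.castRingHom (CategoryTheory.End A₁)) (φ₁ : CategoryTheory.End A₁) P :
      CategoryTheory.End A₁))
    (χ₂ := (Polynomial.eval₂ (Int.castRingHom (CategoryTheory.End A₂)) (φ₂ : CategoryTheory.End A₂) P :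
      CategoryTheory.End A₂)) rfl rfl
  rw [hΨ] at h
  exact (eq_zero_of_prodLift_comp_eq_zero h.symm).1

/-- **`P(φ₁ × φ₂) = 0 ⟹ P(φ₂) = 0`**. [cite: MoonenZarhin1998WeilClasses, §2 (chunk p0002, lines 1–6)]
[cite: MumfordAV1970, §19] -/
theorem eval₂_eq_zero_of_comp_snd (hΨ₁ : Ψ ≫ AbelianVariety.fst A₁ A₂ = AbelianVariety.fst A₁ A₂ ≫ φ₁)
    (hΨ₂ : Ψ ≫ AbelianVariety.snd A₁ A₂ = AbelianVariety.snd A₁ A₂ ≫ φ₂)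
    (hΨ : Polynomial.eval₂ (Int.castRingHom (CategoryTheory.End (A₁.prod A₂)))
      (Ψ : CategoryTheory.End (A₁.prod A₂)) P = 0) :
    Polynomial.eval₂ (Int.castRingHom (CategoryTheory.End A₂)) (φ₂ : CategoryTheory.End A₂) P = 0 := by
  have h := eval₂_prodLift_fst_snd hΨ₁ hΨ₂ P
    (χ₁ := (Polynomial.eval₂ (Int.castRingHom (CategoryTheory.End A₁)) (φ₁ : CategoryTheory.End A₁) P :
      CategoryTheory.End A₁))
    (χ₂ := (Polynomial.eval₂ (Int.castRingHom (CategoryTheory.End A₂)) (φ₂ : CategoryTheory.End A₂) P :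
      CategoryTheory.End A₂)) rfl rfl
  rw [hΨ] at h
  exact (eq_zero_of_prodLift_comp_eq_zero h.symm).2

/-- **Orthogonal factors: `P(Ψ) = 0 ⟹ P(corner₁ Ψ) = 0`** — «the condition that `1 ∈ F` acts as the identity
implies that `F` acts on each factor». [cite: MoonenZarhin1998WeilClasses, §2 (chunk p0002, lines 1–6)]
[cite: Lange2023AbelianVarietiesC, proof of Cor. 2.4.26] -/
theorem eval₂_cornerFst_eq_zero_of_orthogonal (hAB : ∀ f : A₁ ⟶ A₂, f = 0) (hBA : ∀ g : A₂ ⟶ A₁, g = 0)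
    (hΨ : Polynomial.eval₂ (Int.castRingHom (CategoryTheory.End (A₁.prod A₂)))
      (Ψ : CategoryTheory.End (A₁.prod A₂)) P = 0) :
    Polynomial.eval₂ (Int.castRingHom (CategoryTheory.End A₁))
      (cornerFst A₁ A₂ Ψ : CategoryTheory.End A₁) P = 0 :=
  eval₂_eq_zero_of_comp_fst (comp_fst_eq_fst_comp_cornerFst_of_orthogonal hAB hBA Ψ)
    (comp_snd_eq_snd_comp_cornerSnd_of_orthogonal hAB hBA Ψ) hΨ

/-- **Orthogonal factors: `P(Ψ) = 0 ⟹ P(corner₂ Ψ) = 0`**. [cite: MoonenZarhin1998WeilClasses, §2 (chunk p0002,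
lines 1–6)] [cite: Lange2023AbelianVarietiesC, proof of Cor. 2.4.26] -/
theorem eval₂_cornerSnd_eq_zero_of_orthogonal (hAB : ∀ f : A₁ ⟶ A₂, f = 0) (hBA : ∀ g : A₂ ⟶ A₁, g = 0)
    (hΨ : Polynomial.eval₂ (Int.castRingHom (CategoryTheory.End (A₁.prod A₂)))
      (Ψ : CategoryTheory.End (A₁.prod A₂)) P = 0) :
    Polynomial.eval₂ (Int.castRingHom (CategoryTheory.End A₂))
      (cornerSnd A₁ A₂ Ψ : CategoryTheory.End A₂) P = 0 :=
  eval₂_eq_zero_of_comp_snd (comp_fst_eq_fst_comp_cornerFst_of_orthogonal hAB hBA Ψ)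
    (comp_snd_eq_snd_comp_cornerSnd_of_orthogonal hAB hBA Ψ) hΨ

end Factors

/-! ### §3 The product step for Hodge classes -/

section Hodge

/-- **`W_F(A₁) ⊗ ℂ`, `W_F(A₂) ⊗ ℂ` HODGE ⟹ `W_F(A₁ × A₂) ⊗ ℂ` HODGE** (`rᵢ = 2mᵢ`; Moonen–Zarhin §2, `r = r₁ + r₂`;
Schoen §10 «`W_{A′}` has Hodge type `(1,1)`»): for a diagonal `Ψ` (`Ψ ≫ fst = fst ≫ φ₁`, `Ψ ≫ snd = snd ≫ φ₂`), `P`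
monic irreducible of degree `e`, `P(φᵢ) = 0`, `e · 2mᵢ = 2 dim Aᵢ`: if every class of `weilClassesField Aᵢ φᵢ P (2mᵢ)`
is of Hodge type `(mᵢ, mᵢ)` then every class of `weilClassesField (A₁ × A₂) Ψ P (2(m₁ + m₂))` is of Hodge type
`(m₁ + m₂, m₁ + m₂)` — the Weil classes of the product lie in the span of the exterior products `fst^* a ⌣ snd^* b`
(`weilClassesField_prod_le_span_cupProduct`) and Hodge types add under exterior products (Voisin I Thm. 11.38:
`isOfHodgeType_cupProduct_map_fst_map_snd_of_cupPreservesHodgeType`, the cup-product input discharged by the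
multiplicative de Rham theorem `exists_deRhamIsoFamily_holds`).  (For odd `rᵢ` the factors carry no non-zero
Hodge classes while the product may: Moonen–Zarhin's Example.) [cite: MoonenZarhin1998WeilClasses, §2 (chunk
p0002, lines 7–13 and 33–38)] [cite: VoisinHodgeI2002, §11.3.2 Thm. 11.38] [cite: Schoen1998HodgeWeilAddendum, §10 (proof, p. 333)] -/
theorem forall_isOfHodgeType_weilClassesField_prod {m₁ m₂ : ℕ}
    (hΨ₁ : Ψ ≫ AbelianVariety.fst A₁ A₂ = AbelianVariety.fst A₁ A₂ ≫ φ₁)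
    (hΨ₂ : Ψ ≫ AbelianVariety.snd A₁ A₂ = AbelianVariety.snd A₁ A₂ ≫ φ₂) (hPm : P.Monic) (hPe : P.natDegree = e)
    (hPirr : Irreducible (P.map (Int.castRingHom ℚ)))
    (hφ₁ : Polynomial.eval₂ (Int.castRingHom (CategoryTheory.End A₁)) (φ₁ : CategoryTheory.End A₁) P = 0)
    (hφ₂ : Polynomial.eval₂ (Int.castRingHom (CategoryTheory.End A₂)) (φ₂ : CategoryTheory.End A₂) P = 0)
    (her₁ : e * (2 * m₁) = 2 * A₁.dim) (her₂ : e * (2 * m₂) = 2 * A₂.dim)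
    (hH₁ : ∀ c ∈ weilClassesField A₁ φ₁ P (2 * m₁), IsOfHodgeType A₁.dim A₁.X (2 * m₁) m₁ m₁ c)
    (hH₂ : ∀ c ∈ weilClassesField A₂ φ₂ P (2 * m₂), IsOfHodgeType A₂.dim A₂.X (2 * m₂) m₂ m₂ c) :
    ∀ c ∈ weilClassesField (A₁.prod A₂) Ψ P (2 * (m₁ + m₂)),
      IsOfHodgeType (A₁.prod A₂).dim (A₁.prod A₂).X (2 * (m₁ + m₂)) (m₁ + m₂) (m₁ + m₂) c := by
  intro c hc
  rw [AbelianVariety.dim_prod]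
  have hX₁ : IsSmoothProjective A₁.dim A₁.X := Motives.AbelianVariety.isSmoothProjective_holds (A := A₁)
  have hX₂ : IsSmoothProjective A₂.dim A₂.X := Motives.AbelianVariety.isSmoothProjective_holds (A := A₂)
  have hX : IsSmoothProjective (A₁.dim + A₂.dim) (A₁.prod A₂).X := isSmoothProjective_prod hX₁ hX₂
  have hcup : CupPreservesHodgeType (A₁.dim + A₂.dim) (A₁.prod A₂).X :=
    cupPreservesHodgeType_of_multiplicative_deRham
      (fun E _ _ _ => Literature.NumberTheory.Transcendental.exists_deRhamIsoFamily_holds (E := E)) hX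
  obtain ⟨M⟩ := nonempty_hodgeModel_holds hX
  have h : 2 * m₁ + 2 * m₂ = 2 * (m₁ + m₂) := by ring
  have hc' := weilClassesField_prod_le_span_cupProduct hΨ₁ hΨ₂ hPm hPe hPirr hφ₁ hφ₂ her₁ her₂ h hc
  clear hc
  induction hc' using Submodule.span_induction with
  | mem x hx =>
    obtain ⟨a, ha, b, hb, rfl⟩ := hx
    exact isOfHodgeType_cupProduct_map_fst_map_snd_of_cupPreservesHodgeType A₁ A₂ rfl rfl hcup h
      (hH₁ a ha) (hH₂ b hb)
  | zero => exact IsOfHodgeType.zero M _ _ _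
  | add a b _ _ ha hb => exact ha.add hX hb
  | smul t a _ ha => exact ha.smul t

open Literature.AlgebraicGeometry.Milne1999 (powFst powSnd powPair powPair_powFst powPair_powSnd)

/-- `dim A^{a+1} = (a + 1) dim A`. [folklore] -/
private theorem dim_powSucc_eq' (A : Motives.AbelianVariety ℂ) : ∀ a : ℕ, (A.powSucc a).dim = (a + 1) * A.dim
  | 0 => by simp
  | a + 1 => by
    show ((A.powSucc a).prod A).dim = (a + 1 + 1) * A.dim
    rw [AbelianVariety.dim_prod, dim_powSucc_eq' A a]
    ring

/-- **`W_F(A) ⊗ ℂ` HODGE ⟹ `W_F(A^{a+1}) ⊗ ℂ` HODGE for every power** with the diagonal action `powSuccMap φ a`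
(`P` monic irreducible of degree `e`, `P(φ) = 0`, `e · 2m = 2 dim A`; type `((a+1)m, (a+1)m)` in degree
`2(a+1)m`): induction on `a` with the product step. [cite: MoonenZarhin1998WeilClasses, §2 (X ∼ Y^m; chunk p0002)]
[cite: VoisinHodgeI2002, §11.3.2 Thm. 11.38] -/
theorem forall_isOfHodgeType_weilClassesField_powSucc {A : Motives.AbelianVariety ℂ} {φ : A ⟶ A} {m : ℕ}
    (hPm : P.Monic) (hPe : P.natDegree = e) (hPirr : Irreducible (P.map (Int.castRingHom ℚ)))
    (hφ : Polynomial.eval₂ (Int.castRingHom (CategoryTheory.End A)) (φ : CategoryTheory.End A) P = 0)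
    (her : e * (2 * m) = 2 * A.dim)
    (hH : ∀ c ∈ weilClassesField A φ P (2 * m), IsOfHodgeType A.dim A.X (2 * m) m m c) :
    ∀ a : ℕ, ∀ c ∈ weilClassesField (A.powSucc a) (powSuccMap φ a) P (2 * ((a + 1) * m)),
      IsOfHodgeType (A.powSucc a).dim (A.powSucc a).X (2 * ((a + 1) * m)) ((a + 1) * m) ((a + 1) * m) c
  | 0 => by
    rw [powSuccMap_zero_eq, show (0 + 1) * m = m by ring]
    exact hH
  | a + 1 => by
    rw [powSuccMap_succ_eq_powPair, show (a + 1 + 1) * m = (a + 1) * m + m by ring]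
    have hera : e * (2 * ((a + 1) * m)) = 2 * (A.powSucc a).dim := by
      rw [dim_powSucc_eq', show e * (2 * ((a + 1) * m)) = (a + 1) * (e * (2 * m)) by ring, her]
      ring
    exact forall_isOfHodgeType_weilClassesField_prod (A₁ := A.powSucc a) (A₂ := A) (powPair_powFst _ _ _)
      (powPair_powSnd _ _ _) hPm hPe hPirr (eval₂_powSuccMap_eq_zero hφ a) hφ hera her
      (forall_isOfHodgeType_weilClassesField_powSucc hPm hPe hPirr hφ her hH a) hH

end Hodge

/-! ### §4 Orthogonal factors: the product step with no diagonal-action hypothesis -/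

section OrthogonalProduct

/-- **MOONEN–ZARHIN'S IDENTIFICATION FOR TWO ORTHOGONAL FACTORS**: if `Hom(A₁, A₂) = 0 = Hom(A₂, A₁)`, `P` is monic
irreducible of degree `e` with `P(Ψ) = 0` on `A₁ × A₂` and `e · rᵢ = 2 dim Aᵢ`, then
`W_F(A₁ × A₂) ⊗ ℂ ⊆ span_ℂ {fst^* a ⌣ snd^* b | a ∈ W_F(A₁, corner₁ Ψ) ⊗ ℂ, b ∈ W_F(A₂, corner₂ Ψ) ⊗ ℂ}` in degree
`r₁ + r₂` («`F` acts on each factor … diagonal action … `W_F(X)` can be identified with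
`W_F(Y₁^{m₁}) ⊗_F W_F(Y₂^{m₂})`», complexified, as a containment). [cite: MoonenZarhin1998WeilClasses, §2 (chunk
p0002, lines 1–13)] [cite: Lange2023AbelianVarietiesC, proof of Cor. 2.4.26] -/
theorem weilClassesField_prod_le_span_cupProduct_of_orthogonal (hAB : ∀ f : A₁ ⟶ A₂, f = 0)
    (hBA : ∀ g : A₂ ⟶ A₁, g = 0) (hPm : P.Monic) (hPe : P.natDegree = e)
    (hPirr : Irreducible (P.map (Int.castRingHom ℚ)))
    (hΨ : Polynomial.eval₂ (Int.castRingHom (CategoryTheory.End (A₁.prod A₂)))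
      (Ψ : CategoryTheory.End (A₁.prod A₂)) P = 0)
    (her₁ : e * r₁ = 2 * A₁.dim) (her₂ : e * r₂ = 2 * A₂.dim) {m : ℕ} (h : r₁ + r₂ = m) :
    weilClassesField (A₁.prod A₂) Ψ P m ≤
      Submodule.span ℂ (Set.image2
        (fun a b => cupProduct h (complexBetti.map (AbelianVariety.fst A₁ A₂).hom.hom.hom r₁ a)
          (complexBetti.map (AbelianVariety.snd A₁ A₂).hom.hom.hom r₂ b))
        (weilClassesField A₁ (cornerFst A₁ A₂ Ψ) P r₁ : Set (complexBetti A₁.X r₁))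
        (weilClassesField A₂ (cornerSnd A₁ A₂ Ψ) P r₂)) :=
  weilClassesField_prod_le_span_cupProduct (comp_fst_eq_fst_comp_cornerFst_of_orthogonal hAB hBA Ψ)
    (comp_snd_eq_snd_comp_cornerSnd_of_orthogonal hAB hBA Ψ) hPm hPe hPirr
    (eval₂_cornerFst_eq_zero_of_orthogonal hAB hBA hΨ) (eval₂_cornerSnd_eq_zero_of_orthogonal hAB hBA hΨ)
    her₁ her₂ h

/-- **Orthogonal factors: `W_F(Aᵢ, cornerᵢ Ψ) ⊗ ℂ` algebraic ⟹ `W_F(A₁ × A₂, Ψ) ⊗ ℂ` algebraic**, for ANY `Ψ` with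
`P(Ψ) = 0` (`P` monic irreducible of degree `e`, `e · 2mᵢ = 2 dim Aᵢ`). [cite: MoonenZarhin1998WeilClasses, §2
(chunk p0002)] [cite: VoisinHodgeII2003, Prop. 9.20] -/
theorem weilClassesField_prod_le_algebraicClasses_of_orthogonal {m₁ m₂ : ℕ} (hAB : ∀ f : A₁ ⟶ A₂, f = 0)
    (hBA : ∀ g : A₂ ⟶ A₁, g = 0) (hPm : P.Monic) (hPe : P.natDegree = e)
    (hPirr : Irreducible (P.map (Int.castRingHom ℚ)))
    (hΨ : Polynomial.eval₂ (Int.castRingHom (CategoryTheory.End (A₁.prod A₂)))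
      (Ψ : CategoryTheory.End (A₁.prod A₂)) P = 0)
    (her₁ : e * (2 * m₁) = 2 * A₁.dim) (her₂ : e * (2 * m₂) = 2 * A₂.dim)
    (hW₁ : weilClassesField A₁ (cornerFst A₁ A₂ Ψ) P (2 * m₁) ≤ algebraicClasses A₁.X m₁)
    (hW₂ : weilClassesField A₂ (cornerSnd A₁ A₂ Ψ) P (2 * m₂) ≤ algebraicClasses A₂.X m₂) :
    weilClassesField (A₁.prod A₂) Ψ P (2 * (m₁ + m₂)) ≤ algebraicClasses (A₁.prod A₂).X (m₁ + m₂) :=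
  weilClassesField_prod_le_algebraicClasses (comp_fst_eq_fst_comp_cornerFst_of_orthogonal hAB hBA Ψ)
    (comp_snd_eq_snd_comp_cornerSnd_of_orthogonal hAB hBA Ψ) hPm hPe hPirr
    (eval₂_cornerFst_eq_zero_of_orthogonal hAB hBA hΨ) (eval₂_cornerSnd_eq_zero_of_orthogonal hAB hBA hΨ)
    her₁ her₂ hW₁ hW₂

/-- **Orthogonal factors: `W_F(Aᵢ, cornerᵢ Ψ) ⊗ ℂ ⊆ D(Aᵢ) ⊗ ℂ` ⟹ `W_F(A₁ × A₂, Ψ) ⊗ ℂ ⊆ D(A₁ × A₂) ⊗ ℂ`** — the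
«⟸» of Moonen–Zarhin's display for two orthogonal factors, with no hypothesis on the shape of `Ψ`.
[cite: MoonenZarhin1998WeilClasses, §2 (chunk p0002, lines 21–31)] [cite: vanGeemen1994HodgeAV, §2.4] -/
theorem weilClassesField_prod_le_divisorClassesSpan_of_orthogonal {m₁ m₂ : ℕ} (hAB : ∀ f : A₁ ⟶ A₂, f = 0)
    (hBA : ∀ g : A₂ ⟶ A₁, g = 0) (hPm : P.Monic) (hPe : P.natDegree = e)
    (hPirr : Irreducible (P.map (Int.castRingHom ℚ)))
    (hΨ : Polynomial.eval₂ (Int.castRingHom (CategoryTheory.End (A₁.prod A₂)))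
      (Ψ : CategoryTheory.End (A₁.prod A₂)) P = 0)
    (her₁ : e * (2 * m₁) = 2 * A₁.dim) (her₂ : e * (2 * m₂) = 2 * A₂.dim)
    (hW₁ : weilClassesField A₁ (cornerFst A₁ A₂ Ψ) P (2 * m₁) ≤ divisorClassesSpan A₁.X A₁.dim m₁)
    (hW₂ : weilClassesField A₂ (cornerSnd A₁ A₂ Ψ) P (2 * m₂) ≤ divisorClassesSpan A₂.X A₂.dim m₂) :
    weilClassesField (A₁.prod A₂) Ψ P (2 * (m₁ + m₂)) ≤
      divisorClassesSpan (A₁.prod A₂).X (A₁.prod A₂).dim (m₁ + m₂) :=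
  weilClassesField_prod_le_divisorClassesSpan (comp_fst_eq_fst_comp_cornerFst_of_orthogonal hAB hBA Ψ)
    (comp_snd_eq_snd_comp_cornerSnd_of_orthogonal hAB hBA Ψ) hPm hPe hPirr
    (eval₂_cornerFst_eq_zero_of_orthogonal hAB hBA hΨ) (eval₂_cornerSnd_eq_zero_of_orthogonal hAB hBA hΨ)
    her₁ her₂ hW₁ hW₂

/-- **Orthogonal factors: `W_F(Aᵢ, cornerᵢ Ψ) ⊗ ℂ` Hodge ⟹ `W_F(A₁ × A₂, Ψ) ⊗ ℂ` Hodge** (`rᵢ = 2mᵢ`).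
[cite: MoonenZarhin1998WeilClasses, §2 (chunk p0002)] [cite: VoisinHodgeI2002, §11.3.2 Thm. 11.38] -/
theorem forall_isOfHodgeType_weilClassesField_prod_of_orthogonal {m₁ m₂ : ℕ} (hAB : ∀ f : A₁ ⟶ A₂, f = 0)
    (hBA : ∀ g : A₂ ⟶ A₁, g = 0) (hPm : P.Monic) (hPe : P.natDegree = e)
    (hPirr : Irreducible (P.map (Int.castRingHom ℚ)))
    (hΨ : Polynomial.eval₂ (Int.castRingHom (CategoryTheory.End (A₁.prod A₂)))
      (Ψ : CategoryTheory.End (A₁.prod A₂)) P = 0)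
    (her₁ : e * (2 * m₁) = 2 * A₁.dim) (her₂ : e * (2 * m₂) = 2 * A₂.dim)
    (hH₁ : ∀ c ∈ weilClassesField A₁ (cornerFst A₁ A₂ Ψ) P (2 * m₁), IsOfHodgeType A₁.dim A₁.X (2 * m₁) m₁ m₁ c)
    (hH₂ : ∀ c ∈ weilClassesField A₂ (cornerSnd A₁ A₂ Ψ) P (2 * m₂), IsOfHodgeType A₂.dim A₂.X (2 * m₂) m₂ m₂ c) :
    ∀ c ∈ weilClassesField (A₁.prod A₂) Ψ P (2 * (m₁ + m₂)),
      IsOfHodgeType (A₁.prod A₂).dim (A₁.prod A₂).X (2 * (m₁ + m₂)) (m₁ + m₂) (m₁ + m₂) c :=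
  forall_isOfHodgeType_weilClassesField_prod (comp_fst_eq_fst_comp_cornerFst_of_orthogonal hAB hBA Ψ)
    (comp_snd_eq_snd_comp_cornerSnd_of_orthogonal hAB hBA Ψ) hPm hPe hPirr
    (eval₂_cornerFst_eq_zero_of_orthogonal hAB hBA hΨ) (eval₂_cornerSnd_eq_zero_of_orthogonal hAB hBA hΨ)
    her₁ her₂ hH₁ hH₂

end OrthogonalProduct

end HodgeTheory

end Literature.AlgebraicGeometry.HodgeTheory
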